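import Mathlib
import HarnessLib
import Summits.NavierStokesRegularity.NavierStokesRegularity.Theorems.RellichScarApexLocalisationTracelessConeLiouville

/-!
# Traceless half-space Liouville theorem for rate-Type-I slab profiles (line calm-cone-carleman, crux
# ApexLocalisation stmt-NavierStokesRegularity-11719, stub `stub_tracelessHalfspaceLiouville` = S_A)

**Theorem (S_A).** No suitable weak Navier–Stokes solution on the backward slab `]-∞,0[ × ℝ³` with a weak spatial
gradient, `𝐈 < ⊤` and the Type-I RATE `‖u(t,x)‖ ≤ C/√(−t)` that is SCAR-FAINT on an open half-space `{⟪x,e⟫ > 0}`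
through the origin (`‖x‖‖u(t,x)‖ ≤ ε` for `⟪x,e⟫ > 0`, `‖x‖ < δ(ε)`, `−η(ε)‖x‖² < t < 0`) is singular at the
space–time origin.  This is the unconditional case `κ = 0` of K1′ (`stub_tracelessConeLiouville`): the backward
uniqueness hypothesis (BU) of K1′ for the half-space is ESS 2003, Thm. 5.1, in the `C¹₂` class, proved in the tree as
`Carleman.backwardUniqueness_uncurried_c12` (with the unique-continuation input `uniqueContinuation_input_c12` and
the growth bound `e^{0·‖x‖²} = 1`).

References: Escauriaza–Seregin–Šverák 2003 (Thms. 1.4, 4.1, 5.1); Seregin 2014, App. A.3.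
-/

noncomputable section

set_option linter.dupNamespace false

namespace Summit.NavierStokesRegularity.NavierStokesRegularity.Theorems.RellichScarApexLocalisation

open MeasureTheory Set Function Metric Filter Topology TopologicalSpace
open scoped ENNReal NNReal InnerProductSpace RealInnerProductSpace
open Literature.Analysis Literature.Analysis.FluidPDE

local notation "E³" => EuclideanSpace ℝ (Fin 3)

/-- The open backward slab `(-∞, 0) × ℝ³` (time first). -/
local notation "𝕊" => Literature.Analysis.FluidPDE.slab (EuclideanSpace ℝ (Fin 3)) (Set.Iio (0 : ℝ)) isOpen_Iio

/-- The degenerate cone `{y | 0 · ‖y‖ < ⟪y, e⟫}` is the open half-space `{y | 0 < ⟪y, e⟫}`. [folklore] -/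
theorem coneZero_eq_halfspace (e : E³) :
    {y : E³ | 0 * ‖y‖ < ⟪y, e⟫} = {y : E³ | 0 < ⟪y, e⟫} := by
  ext y
  simp

/-- **(BU) for the half-space in the `C¹₂` class** (ESS 2003, Thm. 5.1 = Seregin 2014, Thm. 3.5), in exactly the
shape of the backward-uniqueness hypothesis of `stub_tracelessConeLiouville` at `κ = 0`: a `C¹` function with `C¹`
spatial derivatives on `]0,1[ × {0·‖y‖ < ⟪y,e⟫}`, continuous up to `t = 0` with zero data there, satisfying
`|∂ₜv + Δv| ≤ c₁(|v| + |∇v|)`, `|v| ≤ 1` and `∂ₜv ∈ L²_loc`, vanishes identically.  Proof: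
`Carleman.backwardUniqueness_uncurried_c12` with `uniqueContinuation_input_c12` and `M = 0`.
[cite: EscauriazaSereginSverak2003, Thm. 5.1] -/
theorem coneBU_zero (e : E³) (he : ‖e‖ = 1) :
    ∀ (v : ℝ × E³ → E³) (c₁ : ℝ), 0 ≤ c₁ →
      ContDiffOn ℝ 1 v (Ioo (0 : ℝ) 1 ×ˢ {y : E³ | 0 * ‖y‖ < ⟪y, e⟫}) →
      (∀ e' : E³, ContDiffOn ℝ 1 (Carleman.dx e' v) (Ioo (0 : ℝ) 1 ×ˢ {y : E³ | 0 * ‖y‖ < ⟪y, e⟫})) →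
      ContinuousOn v (Ico (0 : ℝ) 1 ×ˢ {y : E³ | 0 * ‖y‖ < ⟪y, e⟫}) →
      (∀ y : E³, 0 * ‖y‖ < ⟪y, e⟫ → v (0, y) = 0) →
      (∀ z ∈ Ioo (0 : ℝ) 1 ×ˢ {y : E³ | 0 * ‖y‖ < ⟪y, e⟫},
        ‖Carleman.dt v z + Carleman.lap v z‖ ≤ c₁ * (‖v z‖ + Real.sqrt (Carleman.gradSq v z))) →
      (∀ z ∈ Ioo (0 : ℝ) 1 ×ˢ {y : E³ | 0 * ‖y‖ < ⟪y, e⟫}, ‖v z‖ ≤ 1) →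
      (∀ K' ⊆ Ioo (0 : ℝ) 1 ×ˢ {y : E³ | 0 * ‖y‖ < ⟪y, e⟫}, Bornology.IsBounded K' → MeasurableSet K' →
        ∫⁻ z in K', ‖Carleman.dt v z‖ₑ ^ 2 < ∞) →
      ∀ z ∈ Ioo (0 : ℝ) 1 ×ˢ {y : E³ | 0 * ‖y‖ < ⟪y, e⟫}, v z = 0 := by
  intro v c₁ hc₁ hv hvx hcont h0 hBH hbd hH3
  rw [coneZero_eq_halfspace e] at hv hvx hcont hBH hbd hH3 ⊢
  have h0' : ∀ y : E³, 0 < ⟪y, e⟫ → v (0, y) = 0 := fun y hy => h0 y (by rwa [zero_mul])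
  have hgrowth : ∀ z ∈ Ioo (0 : ℝ) 1 ×ˢ {y : E³ | 0 < ⟪y, e⟫}, ‖v z‖ ≤ Real.exp (0 * ‖z.2‖ ^ 2) :=
    fun z hz => by rw [zero_mul, Real.exp_zero]; exact hbd z hz
  exact Carleman.backwardUniqueness_uncurried_c12 (E := E³) (F := E³)
    uniqueContinuation_input_c12 he hc₁ le_rfl hv hvx hcont h0' hBH hgrowth hH3

/-- **S_A (stub_tracelessHalfspaceLiouville).** A suitable weak Navier–Stokes solution on the backward slab with a
weak gradient, `𝐈 < ⊤` and the Type-I RATE `‖u(t,x)‖ ≤ C/√(−t)` which is scar-FAINT on an open half-space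
`{⟪x, e⟫ > 0}` through the origin (`‖x‖‖u(t,x)‖ ≤ ε` for `⟪x,e⟫ > 0`, `‖x‖ < δ(ε)`, `−η(ε)‖x‖² < t < 0`) is NOT
singular at the space–time origin.  Proof: K1′ (`stub_tracelessConeLiouville`) at `κ = 0`, its hypothesis (BU) for
the half-space being ESS 2003 Thm 5.1 in the `C¹₂` class (`coneBU_zero`). [cite: EscauriazaSereginSverak2003, Thm. 5.1] -/
theorem stub_tracelessHalfspaceLiouville :
    ∀ (C : ℝ) (e : E³), ‖e‖ = 1 → ∀ (u : ℝ → E³ → E³) (p : ℝ → E³ → ℝ) (G : ℝ → E³ → E³ →L[ℝ] E³),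
      IsSuitableWeakSolutionOn 𝕊 1 0 u p → HasWeakSpatialGradientOn 𝕊 u G →
      typeIBound (Iio (0 : ℝ) ×ˢ univ) u p G < ⊤ → HasTypeITimeDecay C u →
      (∀ ε : ℝ, 0 < ε → ∃ δ : ℝ, 0 < δ ∧ ∃ η : ℝ, 0 < η ∧ ∀ x : E³, 0 < ⟪x, e⟫ → ‖x‖ < δ →
        ∀ t : ℝ, -η * ‖x‖ ^ 2 < t → t < 0 → ‖x‖ * ‖u t x‖ ≤ ε) →
      ¬ IsBackwardSingularPoint u 0 := by
  intro C e he u p G hsw hwg hI hrate hfaint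
  refine stub_tracelessConeLiouville 0 le_rfl one_pos e he (coneBU_zero e he) C u p G hsw hwg hI hrate ?_
  intro ε hε
  obtain ⟨δ, hδ, η, hη, h⟩ := hfaint ε hε
  exact ⟨δ, hδ, η, hη, fun x hx => h x (by rwa [zero_mul] at hx)⟩

end Summit.NavierStokesRegularity.NavierStokesRegularity.Theorems.RellichScarApexLocalisation

end
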